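import Mathlib
import HarnessLib

/-!
# The Carlen–Lieb–Loss inequality of Hadamard type for permanents

Topic `Literature/LinearAlgebra/Matrix` (companion of the permanent toolkits `PermanentLaplace.lean`,
`PermanentSubperm.lean`). Vendors, as NAMED FACTS, the two theorems of

* E. Carlen, E. H. Lieb, M. Loss, *An inequality of Hadamard type for permanents*, Methods Appl.
  Anal. 13 (2006) 1–18 = arXiv:math/0508096 [CarlenLiebLoss2006]:

**Theorem 1.1.** For any vectors `f_1, …, f_N ∈ ℂ^N` (the columns of the `N × N` matrix `F`),
`|perm F| ≤ (N!/N^{N/2}) ∏_j ‖f_j‖₂`, with equality (for `N > 2`) iff some `f_j = 0` or `F` is a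
rank-one matrix with constant-modulus columns. (Hadamard's inequality `|det F| ≤ ∏ ‖f_j‖` with the
sharp extra factor `N!/N^{N/2}` — attained at the all-ones matrix.)

**Theorem 3.1.** For `K ≤ N` vectors `f_1, …, f_K ∈ ℂ^N` (the rows of a `K × N` matrix),
`𝒫(f_1,…,f_K) := (∑_{j_1<⋯<j_K} |perm[f_{i,j_k}]_{i,k ≤ K}|²)^{1/2} ≤ √(N choose K)·(K!/N^{K/2})·∏_i ‖f_i‖₂`
(the `K`-row sub-permanent `ℓ²`-bound; `K = N` is Thm. 1.1).

## Contents

* `carlenLiebLoss_permanent_le` — Thm. 1.1, verbatim in Mathlib's column-major `Matrix.permanent`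
  (`per M = ∑_σ ∏_i M (σ i) i`; the statement is transpose-invariant, `Matrix.permanent_transpose`),
  with `N^{N/2}` written `√(N^N)` and `‖f_j‖₂ = √(∑_i ‖F i j‖²)`.
* `carlenLiebLoss_subpermanent_le` — Thm. 3.1 (rows `f_i` of a `K × N` matrix; the `K × K`
  sub-permanents over `K`-subsets of columns, enumerated increasingly by `Finset.orderEmbOfFin`).
* `carlenLiebLoss_sq_rows` (PROVED from Thm. 1.1): the squared, row form
  `|∑_σ ∏_i a i (σ i)|²·N^N ≤ (N!)²·∏_i ∑_j |a i j|²` — literally the statement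
  `Summit.ValiantsHypothesis.ValiantsHypothesis.Theses.OneNatPerBit.ProductAnchor` of route
  ValiantsHypothesis/OneNatPerBit (stmt-ValiantsHypothesis-10324), which is therefore
  `carlenLiebLoss_permanent_le ∘ (square, transpose)`.

The cases of equality are recorded in the docstrings only (not needed downstream). Degenerate sizes:
`N = 0` gives `1 ≤ 1` (`per` of the empty matrix is `1`, empty products are `1`, `√(0^0) = 1`).
-/

namespace Literature.LinearAlgebra.Matrix

open scoped BigOperators
open Finset

/-- **Carlen–Lieb–Loss 2006, Theorem 1.1 (Hadamard-type inequality for permanents).** For every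
complex `N × N` matrix `F` with columns `f_j`,
`‖per F‖ ≤ (N! / N^{N/2}) · ∏_j ‖f_j‖₂`, i.e. `‖F.permanent‖ ≤ N!/√(N^N) · ∏_j √(∑_i ‖F i j‖²)`.
Printed: "For any vectors `f⃗_1, …, f⃗_N` in `ℂ^N` we have the inequality
`|perm(F)| ≤ (N!/N^{N/2}) ∏_{j=1}^N |f⃗_j|`." Equality (for `N > 2`) iff some `f_j = 0` or
`F_{j,k} = ξ_j ζ_k r_k` with `|ξ_j| = |ζ_k| = 1`, `r_k > 0`. Two printed proofs: heat-flow
interpolation (§2) and induction on rows via Thm. 3.1 (§3). Not in Mathlib.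
[cite: CarlenLiebLoss2006, Thm. 1.1] -/
def carlenLiebLoss_permanent_le : Prop :=
  ∀ (N : ℕ) (F : _root_.Matrix (Fin N) (Fin N) ℂ),
    ‖F.permanent‖ ≤ (N.factorial : ℝ) / Real.sqrt ((N : ℝ) ^ N) * ∏ j, Real.sqrt (∑ i, ‖F i j‖ ^ 2)

/-- **Carlen–Lieb–Loss 2006, Theorem 3.1 (the `K`-row sub-permanent `ℓ²` bound).** For `K ≤ N` and a
complex `K × N` matrix `f` with rows `f_i`, the `ℓ²`-norm over all `K`-element column sets
`S = {j_1 < ⋯ < j_K}` of the `K × K` sub-permanents `perm (f_{i, j_k})_{i,k}` is at most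
`√(N choose K) · K!/N^{K/2} · ∏_i ‖f_i‖₂`. Printed: "`𝒫(f⃗_1,…,f⃗_K) ≤ √(N choose K) (K!/N^{K/2}) ∏_{j=1}^K |f⃗_j|`",
with `𝒫 = [∑_{1 ≤ j_1 < ⋯ < j_K ≤ N} (perm[f_{i,j_k}])²]^{1/2}` (moduli squared for complex entries;
the proof reduces to nonnegative entries); equality for `K ≥ 2`, no zero row, iff rank one with
constant-modulus rows; `K = N` is Thm. 1.1. [cite: CarlenLiebLoss2006, Thm. 3.1] -/
def carlenLiebLoss_subpermanent_le : Prop :=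
  ∀ (K N : ℕ) (f : _root_.Matrix (Fin K) (Fin N) ℂ), K ≤ N →
    Real.sqrt (∑ S : {S : Finset (Fin N) // S.card = K},
        ‖(f.submatrix id (fun k => (S.1.orderEmbOfFin S.2 k : Fin N))).permanent‖ ^ 2)
      ≤ Real.sqrt (N.choose K : ℝ) * ((K.factorial : ℝ) / Real.sqrt ((N : ℝ) ^ K)) *
          ∏ i, Real.sqrt (∑ j, ‖f i j‖ ^ 2)

/-- **Squared row form of Thm. 1.1** (proved from the named fact): for every array
`a : Fin N → Fin N → ℂ`, `‖∑_σ ∏_i a i (σ i)‖² · N^N ≤ (N!)² · ∏_i ∑_j ‖a i j‖²`. This is CLL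
Thm. 1.1 for the TRANSPOSE of `Matrix.of a` (Mathlib's `per M = ∑_σ ∏_i M (σ i) i`, so
`per (of a)ᵀ = ∑_σ ∏_i a i (σ i)`), squared; the columns of the transpose are the rows `a i`.
[cite: CarlenLiebLoss2006, Thm. 1.1] -/
theorem carlenLiebLoss_sq_rows (h : carlenLiebLoss_permanent_le) (N : ℕ) (a : Fin N → Fin N → ℂ) :
    ‖∑ σ : Equiv.Perm (Fin N), ∏ i, a i (σ i)‖ ^ 2 * (N : ℝ) ^ N ≤
      (N.factorial : ℝ) ^ 2 * ∏ i, ∑ j, ‖a i j‖ ^ 2 := by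
  -- the permanent of the transpose of `of a` is the row-indexed sum
  have hper : (_root_.Matrix.of fun i j => a j i).permanent =
      ∑ σ : Equiv.Perm (Fin N), ∏ i, a i (σ i) := by
    simp [_root_.Matrix.permanent]
  have hF := h N (_root_.Matrix.of fun i j => a j i)
  rw [hper] at hF
  simp only [_root_.Matrix.of_apply] at hF
  -- `hF : ‖∑ σ, ∏ i, a i (σ i)‖ ≤ N! / √(N^N) * ∏ j, √(∑ i, ‖a j i‖ ^ 2)`
  have hD : 0 < (N : ℝ) ^ N := by
    rcases Nat.eq_zero_or_pos N with rfl | hN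
    · simp
    · positivity
  have hrow : ∀ j, 0 ≤ ∑ i, ‖a j i‖ ^ 2 := fun j => Finset.sum_nonneg fun i _ => by positivity
  have hsq := pow_le_pow_left₀ (norm_nonneg _) hF 2
  have hexpand : ((N.factorial : ℝ) / Real.sqrt ((N : ℝ) ^ N) *
        ∏ j, Real.sqrt (∑ i, ‖a j i‖ ^ 2)) ^ 2
      = (N.factorial : ℝ) ^ 2 / (N : ℝ) ^ N * ∏ j, ∑ i, ‖a j i‖ ^ 2 := by
    rw [mul_pow, div_pow, Real.sq_sqrt hD.le, ← Finset.prod_pow]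
    congr 1
    exact Finset.prod_congr rfl fun j _ => Real.sq_sqrt (hrow j)
  rw [hexpand] at hsq
  have hD' : (N : ℝ) ^ N ≠ 0 := hD.ne'
  calc ‖∑ σ : Equiv.Perm (Fin N), ∏ i, a i (σ i)‖ ^ 2 * (N : ℝ) ^ N
      ≤ ((N.factorial : ℝ) ^ 2 / (N : ℝ) ^ N * ∏ j, ∑ i, ‖a j i‖ ^ 2) * (N : ℝ) ^ N :=
        mul_le_mul_of_nonneg_right hsq hD.le
    _ = (N.factorial : ℝ) ^ 2 * ∏ i, ∑ j, ‖a i j‖ ^ 2 := by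
        rw [div_mul_eq_mul_div, div_mul_cancel₀ _ hD']

end Literature.LinearAlgebra.Matrix
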